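import Summits.Ventures.PackingBounds.ThreePointCert.Check

/-!
# Kernel checker for EXACT (slack-free) three-point certificates with face-structured blocks

Framing: lottery ticket; floor = certified bounds/negative ranges. Venture `PackingBounds`
(cell `pub-packcert`), three-point SDP family; built for the exact value-`99` certificate behind
`A(9, arccos 1/3) ≤ 98` (`SphericalCodes.NineDimThirdCounting`), where the Bachoc–Vallentin
identities must hold EXACTLY (value exactly `99`, every block singular on its optimal face), so the
dyadic-with-slack format of `ThreePointCert.Check` cannot be used.

Programs only (plain `List`/`ℤ`/`ℕ`, run by `decide`); meaning and soundness are in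
`ThreePointCert.SoundExact`.  Format:
* every positive semidefinite block is given on its face: `S = cμ·I + L Lᵀ + Δ` (`PSDBlk`: `L` with
  offset-encoded natural-number rows as in `ThreePointCert.CheckFast`, `Δ` a sparse symmetric
  integer correction; `S ⪰ 0` as soon as `Σ|Δ| ≤ cμ`, checked by `psdOK`), lifted to the ambient
  basis by `V = [diag(lv); C]` (`Lift`), `M = V S Vᵀ`;
* the three-point part is `Σ_k M_k Σ_{a,b} (G_k)_{ab} sym6(u^a v^b QI_k)` with `G_k = U S Uᵀ` a densely
  lifted face block (`FBlkX`, expansion `FPolyX`, chunk check `FchunkOKX`);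
* the sums of squares of `(ii)` are `Σ_{j,l} M_{jl} b_j b_l` over ARBITRARY integer basis
  polynomials `b_j` (S3-adapted bases of the producer; for the two-dimensional isotypic type a pair
  `(b¹, b²)` with weights `3, 1`), expansion `partRows`, chunk check `partChunkOK`;
* `(ii)` is the exact integer identity `κ_F·FP + Σ_i κ_i m_i·TOT_i ≡ 0` (`checkIIX`), `(i)` is the
  exact factorisation `κ_Z·ZI ≡ w·h` (`checkIZ`) plus a slackful sums-of-squares certificate
  `κ_H·h - e ≡ EH₀ + g_q EH₁ + ρ`, `Σ|ρ| < e` for `h > 0` on `[-1, s]` (`checkH`), the value is the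
  exact equality `Λ W + AI(1) + FI(1,1,1) = N·Λ W` (`checkValX`).
All identities are tested trie-free (sorted merge, all coefficients zero) as in
`ThreePointCert.CheckFastFZ` / `CheckResidualZ`.

## References
* C. Bachoc, F. Vallentin, J. Amer. Math. Soc. 21 (2008), Theorem 4.2. [`BachocVallentin2007`]
* F. C. Machado, F. M. de Oliveira Filho, Exp. Math. 27 (2018), Lemma 3.1. [`MachadoDeOliveiraFilho2018`]
-/

noncomputable section

namespace Summit.Ventures.PackingBounds.ThreePointCert

open Literature.Geometry.DiscreteGeometry Literature.Geometry.DiscreteGeometry.PolyCert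
open Literature.Geometry.DiscreteGeometry.PolyCert.SPoly

/-! ### Trie-free zero test -/

/-- All coefficients of a term list vanish. -/
def allZero (p : SPoly) : Bool := p.all fun mc => mc.2 == 0

/-! ### Face blocks `S = cμ I + L Lᵀ + Δ` -/

/-- A positive semidefinite block on its face: `S = cmu·I + L Lᵀ + Δ` (`f × f`), the rows of `L`
offset-encoded (`x : ℕ` stands for `x - B`, `BB = B²` checked), `Δ` a sparse list of symmetric
corrections `(i, j, v)` (`i ≤ j`; entry `(i,j)` and `(j,i)` get `v`, a diagonal entry once). -/
structure PSDBlk where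
  /-- face dimension -/
  f : ℕ
  /-- offset of the rows of `L` -/
  B : ℕ
  /-- `B * B` (data, checked) -/
  BB : ℕ
  /-- rows of `L`, entries `e + B` -/
  L : List (List ℕ)
  /-- the multiple of the identity -/
  cmu : ℕ
  /-- sparse symmetric correction -/
  delta : List (ℕ × ℕ × ℤ)

/-- Fused offset dot product (a copy of `ThreePointCert.CheckFast.dotOffZ`, kept here so that data
files need only import this file): decodes `Σ (a_k - B)(b_k - B)` from one `ℕ` pass. -/
def dotNZ (B BB : ℕ) (a : List ℕ) : List ℕ → ℕ → ℕ → ℤ :=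
  a.rec (motive := fun _ => List ℕ → ℕ → ℕ → ℤ) (fun _ acc s => Int.subNatNat acc (Nat.mul B s))
    (fun x _ ih b acc s => b.casesOn (motive := fun _ => ℤ) (Int.subNatNat acc (Nat.mul B s))
      (fun y b' => ih b' (Nat.add acc (Nat.add (Nat.mul x y) BB)) (Nat.add s (Nat.add x y))))

/-- Row `i` of an `ℕ`-matrix (default empty). -/
def getRowN (L : List (List ℕ)) (i : ℕ) : List ℕ := L.getD i []

/-- The correction entry `Δ(i,j) = Σ_{(a,b,v) ∈ delta, {a,b} = {i,j}} v`. -/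
def deltaEnt (dl : List (ℕ × ℕ × ℤ)) (i j : ℕ) : ℤ :=
  (dl.map fun e => if (e.1 = i ∧ e.2.1 = j) ∨ (e.1 = j ∧ e.2.1 = i) then e.2.2 else 0).sum

/-- Entry `S(i,j) = cmu·[i=j] + (L Lᵀ)_{ij} + Δ(i,j)`. -/
def Sent (p : PSDBlk) (i j : ℕ) : ℤ :=
  (if i = j then (p.cmu : ℤ) else 0) + dotNZ p.B p.BB (getRowN p.L i) (getRowN p.L j) 0 0 +
    deltaEnt p.delta i j

/-- The rows of `S` (`f` rows of length `f`). -/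
def Srows (p : PSDBlk) : List (List ℤ) := (List.range p.f).map fun i => (List.range p.f).map fun j => Sent p i j

/-- `ℓ¹` mass of the correction with off-diagonal entries counted twice. -/
def deltaMass (dl : List (ℕ × ℕ × ℤ)) : ℕ :=
  (dl.map fun e => (if e.1 = e.2.1 then 1 else 2) * e.2.2.natAbs).sum

/-- The PSD check of a face block: `BB = B²`, the rows of `L` have length `≤ f`, the corrections are
indexed inside the block, and `Σ|Δ| (off-diagonal twice) ≤ cmu`. -/
def psdOK (p : PSDBlk) : Bool :=
  (p.BB == p.B * p.B) && (p.L.all fun r => decide (r.length ≤ p.f)) &&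
    (p.delta.all fun e => decide (e.1 < p.f) && decide (e.2.1 < p.f)) && decide (deltaMass p.delta ≤ p.cmu)

/-! ### Lifting to the ambient basis: `V = [diag(lv); C]`, `M = V S Vᵀ` -/

/-- The lift of a face block: leading values `lv` (ambient coordinate `a < f` is `lv_a ×` face
coordinate `a`) and the dense rows `C` of the dependent ambient coordinates `f, f+1, …`. -/
structure Lift where
  /-- leading values, length `f` -/
  lv : List ℤ
  /-- dependent rows, each of length `f` -/
  C : List (List ℤ)

/-- Ambient dimension `m = f + |C|`. -/
def Lift.m (V : Lift) : ℕ := V.lv.length + V.C.length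

/-- Integer dot product by one pass. -/
def dotZ : List ℤ → List ℤ → ℤ → ℤ
  | x :: a, y :: b, acc => dotZ a b (acc + x * y)
  | _, _, acc => acc

/-- `Σ_a c_a · row_a` for a coefficient list `c` against the rows `S` (padded by the zero row of length `f`). -/
def combRows (f : ℕ) : List ℤ → List (List ℤ) → List ℤ
  | ci :: c, row :: S => List.zipWith (· + ·) (row.map fun x => ci * x) (combRows f c S)
  | _, _ => List.replicate f 0

/-- Row `j` of `W = V S` (a list over face indices): `lv_j · S_j` for `j < f`, `Σ_a C_{j-f,a} S_a` else. -/
def Wrow (V : Lift) (S : List (List ℤ)) (f j : ℕ) : List ℤ :=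
  if j < f then (S.getD j []).map fun x => V.lv.getD j 0 * x
  else combRows f (V.C.getD (j - f) []) S

/-- Row `j` of `M = V S Vᵀ` in the ambient order (leads first, then dependents):
`[lv_b · W_{jb}]_b ++ [⟨C_i, W_j⟩]_i`. -/
def Mrow (V : Lift) (S : List (List ℤ)) (f j : ℕ) : List ℤ :=
  List.zipWith (· * ·) (Wrow V S f j) V.lv ++ V.C.map fun ci => dotZ ci (Wrow V S f j) 0

/-! ### Sums of squares over arbitrary basis polynomials (the parts of `(ii)`) -/

/-- One S3-adapted part of a sum-of-squares multiplier: ambient basis polynomials `bs` (and second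
components `bs2` with the weights `3, 1` of the two-dimensional isotypic type when `two = true`),
the lift and the face block.  Value: `Σ_{j,l} M_{jl} (b_j b_l)` resp. `Σ_{j,l} M_{jl} (3 b¹_j b¹_l + b²_j b²_l)`. -/
structure SymPart where
  /-- two-component (standard representation) part? -/
  two : Bool
  /-- basis polynomials (first components) -/
  bs : List SPoly
  /-- second components (empty unless `two`) -/
  bs2 : List SPoly
  /-- the lift `V` -/
  V : Lift
  /-- the face block -/
  psd : PSDBlk

/-- The linear combination `Σ_l c_l · b_l` of basis polynomials. -/
def linComb (cs : List ℤ) (bs : List SPoly) : SPoly :=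
  mergeAllB 16 (List.zipWith (fun (c : ℤ) (bl : SPoly) => smul c bl) cs bs)

/-- The polynomial of row `j`: `b_j · (Σ_l M_{jl} b_l)` (`+` the second components with the weights `3, 1`). -/
def rowPolyX (P : SymPart) (S : List (List ℤ)) (j : ℕ) : SPoly :=
  let Mj := Mrow P.V S P.psd.f j
  let one := mulN (P.bs.getD j []) (linComb Mj P.bs)
  if P.two then
    mergeAll [smul 3 one, mulN (P.bs2.getD j []) (linComb Mj P.bs2)]
  else one

/-- Rows `j0, …, j0+cnt-1` of a part. -/
def partRows (P : SymPart) (j0 cnt : ℕ) : SPoly :=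
  let S := Srows P.psd
  mergeAllB 16 ((List.range cnt).map fun i => rowPolyX P S (j0 + i))

/-- Shape conditions of a part: `|lv| = f`, every `C` row has length `f`, `|bs| = m` (`= |bs2|` if `two`),
`S` is `f × f` (rows of `L` at most `f`). -/
def partShapeOK (P : SymPart) : Bool :=
  decide (P.V.lv.length = P.psd.f) && (P.V.C.all fun r => decide (r.length = P.psd.f)) &&
    decide (P.bs.length = P.V.m) && (!P.two || decide (P.bs2.length = P.V.m)) &&
    psdOK P.psd

/-- Chunk check of a part: `Dprev + rows [j0, j0+cnt) - Dnext ≡ 0` (trie-free). -/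
def partChunkOK (P : SymPart) (j0 cnt : ℕ) (Dprev Dnext : SPoly) : Bool :=
  decide (j0 + cnt ≤ P.V.m) && allZero (mergeAll [Dprev, partRows P j0 cnt, neg Dnext])

/-! ### The three-point part with lifted face blocks -/

/-- Row `j` of `M = U S Uᵀ` for a dense integer lift `U` (`m` rows of length `f`):
`M_{jl} = ⟨Σ_a U_{ja} S_a, U_l⟩`. -/
def MrowU (U : List (List ℤ)) (S : List (List ℤ)) (f j : ℕ) : List ℤ :=
  U.map fun Ul => dotZ (combRows f (U.getD j []) S) Ul 0

/-- A block of the three-point part: degree `k`, the dense lift `U` (`m × f`, monomial basis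
`u^0, …, u^{m-1}` to face coordinates) and the face block; value `Σ_{a,b<m} (U S Uᵀ)_{ab} sym6(u^a v^b Q n k)`. -/
structure FBlkX where
  /-- degree of the kernel `Q n k` -/
  k : ℕ
  /-- the dense lift, `m` rows of length `f` -/
  U : List (List ℤ)
  /-- the face block -/
  psd : PSDBlk

/-- One block: `M_k · Σ_{a,b<m} M_{ab} · symTabG n k a b`. -/
def FbPolyX (n d : ℕ) (b : FBlkX) : SPoly :=
  let S := Srows b.psd
  let m := b.U.length
  smul (Mfac d b.k : ℤ) (mergeAllB 16 ((List.range m).map fun a =>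
    mergeAllB 16 (List.zipWith (fun (c : ℤ) (pb : ℕ) => smul c (symTabG n b.k a pb))
      (MrowU b.U S b.psd.f a) (List.range m))))

/-- The three-point part of a block list. -/
def FPolyX (n d : ℕ) (bs : List FBlkX) : SPoly := mergeAll (bs.map (FbPolyX n d))

/-- Shape conditions of a three-point block. -/
def fblkShapeOK (d : ℕ) (b : FBlkX) : Bool :=
  decide (b.k ≤ d) && (b.U.all fun r => decide (r.length = b.psd.f)) && psdOK b.psd

/-- Block-chunk check of the three-point part: `Dprev + FPolyX bs - Dnext ≡ 0` (trie-free). -/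
def FchunkOKX (n d : ℕ) (bs : List FBlkX) (Dprev Dnext : SPoly) : Bool :=
  allZero (mergeAll [Dprev, FPolyX n d bs, neg Dnext])

/-! ### The certificate and the final checks -/

/-- An exact three-point certificate (`B = 0`): dimension `n`, degree `d`, angle `s = p/q`, common
scale `Λ` of the two- and three-point parts (`a_k = A_k/Λ`, `F = F_M/Λ`), the claimed value `N`
(`1 + A(1) + F(1,1,1) = N` exactly), the two-point coefficients, the three-point blocks, the parts of
the five multipliers `1, m₁, m₂, m₃, s₄` of `(ii)` with their multipliers `κ`, and the `(i)`-side data: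
`κ_Z`, the vanishing factor `w` (univariate, data), the cofactor `h`, `κ_H`, `e`, and the two Gram
blocks of the positivity certificate of `h`. -/
structure CertX where
  /-- dimension -/
  n : ℕ
  /-- degree -/
  d : ℕ
  /-- numerator of `s` -/
  p : ℤ
  /-- denominator of `s` -/
  q : ℕ
  /-- common scale `Λ > 0` -/
  lam : ℕ
  /-- the exact value `N` -/
  N : ℕ
  /-- `A_0, …, A_d` -/
  A : List ℕ
  /-- three-point blocks -/
  F : List FBlkX
  /-- parts of the multiplier-`1` sum of squares, then of `m₁`, `m₂`, `m₃`, `s₄` -/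
  R0 : List SymPart
  /-- see `R0` -/
  R1 : List SymPart
  /-- see `R0` -/
  R2 : List SymPart
  /-- see `R0` -/
  R3 : List SymPart
  /-- see `R0` -/
  R4 : List SymPart
  /-- multiplier of `FP` in `(ii)` (positive) -/
  kF : ℕ
  /-- multipliers of `TOT_0 … TOT_4` in `(ii)` -/
  kR : List ℕ
  /-- multiplier of `ZI` in `(i)` (positive) -/
  kZ : ℕ
  /-- the vanishing factor `w(u)` of `(i)` -/
  wP : SPoly
  /-- the cofactor `h(u)` -/
  hP : SPoly
  /-- multiplier of `h` in its positivity certificate -/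
  kH : ℕ
  /-- the positive constant `e` of the positivity certificate -/
  eH : ℕ

/-- `Λ · W`. -/
def CertX.LW (c : CertX) : ℕ := c.lam * Wfac c.d

/-- Claimed expansions of an exact certificate (each validated separately by chunk checks). -/
structure PolysX where
  /-- the three-point part `FP ≡ FPolyX` -/
  FP : SPoly
  /-- totals of the parts of the five multipliers: `TOT_i ≡ Σ_parts (all rows)` -/
  TOT : List SPoly
  /-- Gram expansions of the positivity certificate of `h` (multipliers `1`, `g_q`) -/
  EH0 : SPoly
  /-- see `EH0` -/
  EH1 : SPoly

/-- `ZI = -(Λ W + AI(u) + 3 FI(u,u,1))` (the slack of `(i)` in integer units, `B = 0`). -/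
def ZIX (c : CertX) (P : PolysX) : SPoly :=
  normalize (neg (C (c.LW : ℤ) ++ APolyG c.n c.d c.A ++ smul 3 (substUU1 P.FP)))

/-- Check of `(i)`, exact part: `κ_Z · ZI ≡ w · h`. -/
def checkIZ (c : CertX) (P : PolysX) : Bool :=
  decide (0 < c.kZ) && allZero (mergeAll [smul (c.kZ : ℤ) (ZIX c P), neg (mulN c.wP c.hP)])

/-- Check of `(i)`, positivity of the cofactor: `Σ|κ_H h - e - EH₀ - g_q EH₁| < e`. -/
def checkH (c : CertX) (P : PolysX) : Bool :=
  decide (absSum (mergeAll [smul (c.kH : ℤ) c.hP, neg (C (c.eH : ℤ)), neg P.EH0, neg (mulN (gqU c.p c.q) P.EH1)]) < c.eH)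

/-- Check of `(ii)`: `κ_F FP + κ_0 TOT_0 + m₁ κ_1 TOT_1 + m₂ κ_2 TOT_2 + m₃ κ_3 TOT_3 + s₄ κ_4 TOT_4 ≡ 0`. -/
def checkIIX (c : CertX) (P : PolysX) : Bool :=
  decide (0 < c.kF) && decide (P.TOT.length = 5) && decide (c.kR.length = 5) &&
  allZero (mergeAll [smul (c.kF : ℤ) P.FP, smul (c.kR.getD 0 0 : ℤ) (P.TOT.getD 0 []),
    mulN (m1P c.p c.q) (smul (c.kR.getD 1 0 : ℤ) (P.TOT.getD 1 [])),
    mulN (m2P c.p c.q) (smul (c.kR.getD 2 0 : ℤ) (P.TOT.getD 2 [])),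
    mulN (m3P c.p c.q) (smul (c.kR.getD 3 0 : ℤ) (P.TOT.getD 3 [])),
    mulN p4 (smul (c.kR.getD 4 0 : ℤ) (P.TOT.getD 4 []))])

/-- The exact value: `Λ W + AI(1) + FI(1,1,1) = N · Λ W`. -/
def checkValX (c : CertX) (P : PolysX) : Bool :=
  decide ((c.LW : ℤ) + coeffSum (APolyG c.n c.d c.A) + coeffSum P.FP = (c.N : ℤ) * c.LW)

/-- Side conditions: `n ≥ 4`, `0 < q`, `-q ≤ p ≤ q`, `0 < Λ`, `|A| = d + 1`, shapes of all blocks and parts. -/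
def checkSideX (c : CertX) : Bool :=
  decide (4 ≤ c.n) && decide (0 < c.q) && decide (c.p ≤ (c.q : ℤ)) && decide (-(c.q : ℤ) ≤ c.p) &&
    decide (0 < c.lam) && decide (c.A.length = c.d + 1) && (c.F.all (fblkShapeOK c.d)) &&
    (c.R0.all partShapeOK) && (c.R1.all partShapeOK) && (c.R2.all partShapeOK) &&
    (c.R3.all partShapeOK) && (c.R4.all partShapeOK)

end Summit.Ventures.PackingBounds.ThreePointCert

end
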